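import Summits.HubbardSuperconductivity.HubbardSuperconductivity.Theses.ProjectedBCSGas

/-!
# Route `ProjectedBCSGas` — assembly item `Assembly` (stmt-HubbardSuperconductivity-1238)

`ProjectedBCSGas.Assembly` (Theses/ProjectedBCSGas.lean rev 1) is the curried implication
`RVBShadowing → ProjectedBCSPairLRO → HubbardSuperconductivity`
from the route's items to the summit statement `HubbardSuperconductivity`. It is, binder for binder, the type of the route file's
DECIDING THEOREM `ProjectedBCSGas.closes` (planner-authored glue, elaborated with the route file and certified
by `#h21_check_closes`): the items are exactly its hypotheses and its conclusion is the
sub-problem statement. This file closes the assembly item BY NAME with that glue — the theorem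
below has type literally `Summit.HubbardSuperconductivity.HubbardSuperconductivity.Theses.ProjectedBCSGas.Assembly` and its proof term is `ProjectedBCSGas.closes`. Pure logic over the
route's own declarations: no analysis, no new definitions, no restatement of any item.

Source for the order parameter / summit matrix being assembled: D. J. Scalapino, Phys. Rep. 250
(1995) 329, §2.
-/

-- the mandated namespace `Summit.<Summit>.<Problem>.Theorems` repeats `HubbardSuperconductivity`
-- (single-problem summit, D-0017), which the `dupNamespace` linter flags on every declaration
set_option linter.dupNamespace false

namespace Summit.HubbardSuperconductivity.HubbardSuperconductivity.Theorems

/-- **Assembly of route `ProjectedBCSGas`** (item `stmt-HubbardSuperconductivity-1238`):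
`RVBShadowing → ProjectedBCSPairLRO → HubbardSuperconductivity`.
The route's deciding theorem `ProjectedBCSGas.closes` takes the items as named hypotheses and concludes the
sub-problem statement; read as a closed implication it is exactly `ProjectedBCSGas.Assembly`, so the item
is closed by the planner's certified glue itself. [folklore] -/
theorem projectedBCSGas_assembly_proof :
    Summit.HubbardSuperconductivity.HubbardSuperconductivity.Theses.ProjectedBCSGas.Assembly :=
  Summit.HubbardSuperconductivity.HubbardSuperconductivity.Theses.ProjectedBCSGas.closes

end Summit.HubbardSuperconductivity.HubbardSuperconductivity.Theorems
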